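import Summits.AnomalousDissipation.AnomalousDissipation.Theorems.SolenoidalFractalHomogenisationLagrangianStepD1TailBoundPair
import Summits.AnomalousDissipation.AnomalousDissipation.Theorems.SolenoidalFractalHomogenisationLagrangianStepD1TailBoundAdj
import HarnessLib

/-!
# K1L_D (stmt-AnomalousDissipation-27980) — REGISTERED STUB `stub_D1_slotPairData` (registry v18/v19, by name) and the v17 text `stub_D1_residueTail`:
# THE TAIL OF THE PERIOD-MEAN SIDEBAND FEEDBACK BEYOND `excQS` AND `pairQS` IS `RelSmall` OF SIZE `1/200000`, UNIFORMLY IN `ν ∈ (0, 1/40]`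
# (`--supports stmt-AnomalousDissipation-27980`, by-name stub)

Summits-side file of route `SolenoidalFractalHomogenisation` (prover seat `ad-sawtooth-k1loc-p1` g13, lane A owner; registry v18 of record D26-12, planner
ad-ideate-p1 g26; certificate spine `…D1TailCert` by planner ad-ideate-p5 g14, port prover ad-k1loc-p3 g8).  Everything proved; no definitions, no named
facts, no sorry.
* `frob_gTail_le` — lane A's table `gTail j j' = G0·(τⱼ/‖mⱼ‖)·Bst j'·e^{−θmin}` has Frobenius weight `Σ gTail²/(wN·wN) ≤ 676·(G0e^{−θmin})²·(8·7·10¹⁶)·(44·10¹²) ≤ (1/23)²`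
  (`D1TailCert.frob_product_le`, `ApickC_sq_div_le`, `Bst_sq_div_le`, `G0_exp_sq_le`);
* **`tail_bound_all`** — `hbound`: for EVERY ordered slot pair `|tailKernel ν S p q j j'| ≤ gTail j j'·√PpSq_j(p)·√PpSq_{j'}(q)` (cases A `j ≥ j'+2`, B `j < j'`,
  C diagonal, D forward colinear pairs `(2l+1,2l)`, E adjacent non-colinear pairs `(2l+2,2l+1)` and `(0,25)`);
* **`stub_D1_slotPairData`** — THE REGISTERED STUB, by name: `⟨gTail, frob_gTail_le, tailKernel ν S, bsymb_tail_eq_slotPair, tail_bound_all⟩`;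
* **`stub_D1_residueTail`** — the v17 text (now a theorem in-skeleton) via `D1TailCert.relSmall_tail_of_table`.
WHAT THIS MEANS: the exact ν-dependent effective family `Sideband.psiStar` of the cubature word equals `excQS + pairQS` up to a relative `1/200000` in the
`RelSmall` currency of `WCrossing`, uniformly on the viscosity window — the diagonal (`κ = 1`, `…SidebandDiagIdentity`) and the colinear pair memory
(`…SidebandPairIdentity`) are EXACT, everything else decays through at least one full slot (`e^{−θmin} ≤ 10⁻¹²`).  NOT a proof of K1L_D (other registered stubs
remain: `stub_D1_V0`, `stub_effectiveFrameEnergyL_bandKill`, `stub_Vmod_of_V`, `stub_Z7_alphaBeta`, `stub_cellInputs_transfer`) and NOT a proof of anomalous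
dissipation; rung leaf F-D1.A0 only.
-/

set_option linter.dupNamespace false

noncomputable section

namespace Summit.AnomalousDissipation.AnomalousDissipation.Theorems.SolenoidalFractalHomogenisation.LagrangianStep.D1Tail

open Summit.AnomalousDissipation.AnomalousDissipation.Theorems
open Summit.AnomalousDissipation.AnomalousDissipation.Theorems.SolenoidalFractalHomogenisation.LagrangianStep
open Summit.AnomalousDissipation.AnomalousDissipation.Theorems.SolenoidalFractalHomogenisation.LagrangianStep.WCrossing
open Summit.AnomalousDissipation.AnomalousDissipation.Theorems.SolenoidalFractalHomogenisation.LagrangianStep.D1ResidueCert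
open Summit.AnomalousDissipation.AnomalousDissipation.Theorems.SolenoidalFractalHomogenisation.LagrangianStep.D1TailCert
open Summit.AnomalousDissipation.AnomalousDissipation.Theorems.SolenoidalFractalHomogenisation.LagrangianStep.Sideband
open Literature.Analysis Literature.Analysis.FluidPDE Literature.Analysis.FunctionSpaces Literature.Analysis.FunctionSpaces.Torus
open Literature.Analysis.FluidPDE.Torus Literature.Analysis.FluidPDE.LatticeShear
open Set Real

/-! ## §1 The Frobenius weight of lane A's table -/

/-- `(τⱼ/‖mⱼ‖)² = 8·ApickC j²`. [folklore] -/
theorem tau_div_norm_sq (j : Fin 26) : ((cubatureWord.phase j).τ / ‖latticeVec (cubatureWord.phase j).m‖) ^ 2 = 8 * ApickC j ^ 2 := by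
  unfold ApickC
  have hm : ‖latticeVec (cubatureWord.phase j).m‖ ≠ 0 := (norm_m_pos j).ne'
  have h2 : Real.sqrt 2 ^ 2 = 2 := Real.sq_sqrt (by norm_num)
  field_simp
  rw [h2]
  ring

/-- **Frobenius weight of lane A's table**: `Σ_{jj'} gTail j j'²/(wN j·wN j') ≤ (1/23)²` (true value ≈ `5·10⁻⁴`). [cite: ArmstrongVicol2025, §3] -/
theorem frob_gTail_le : ∑ j, ∑ j', gTail j j' ^ 2 / (wN j * wN j') ≤ (1 / 23) ^ 2 := by
  have hA : ∀ j, ((cubatureWord.phase j).τ / ‖latticeVec (cubatureWord.phase j).m‖) ^ 2 / wN j ≤ 8 * (7 * 10 ^ 16) := by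
    intro j
    rw [tau_div_norm_sq, mul_div_assoc]
    exact mul_le_mul_of_nonneg_left (ApickC_sq_div_le j) (by norm_num)
  have h := frob_product_le hA Bst_sq_div_le
  have hg : ∀ j j', gTail j j' = G0 * ((cubatureWord.phase j).τ / ‖latticeVec (cubatureWord.phase j).m‖) * Bst j' * Real.exp (-θmin) := fun _ _ => rfl
  simp only [hg]
  refine h.trans ?_
  calc 676 * ((G0 * Real.exp (-θmin)) ^ 2 * (8 * (7 * 10 ^ 16) * (44 * 10 ^ 12)))
      ≤ 676 * ((1 / (16 * 97 * 3720)) ^ 2 * (1 / 10 ^ 12) ^ 2 * (8 * (7 * 10 ^ 16) * (44 * 10 ^ 12))) := by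
        have := G0_exp_sq_le
        nlinarith
    _ ≤ (1 / 23) ^ 2 := by norm_num

/-! ## §2 `hbound`: every ordered slot pair -/

/-- Case E (inner) with the slot indices as variables. [cite: ArmstrongVicol2025, §3] -/
theorem tail_bound_caseE_inner' {ν : ℝ} (hν : ν ∈ Ioc (0:ℝ) (1 / 40)) {S : T4} (hS : Torus.NearIso S (10 / 11) (11 / 10)) (p q : Fin 3 → ℝ)
    (l : Fin 12) {j j' : Fin 26} (hj : j = ⟨2 * (l.val + 1), by have := l.isLt; omega⟩) (hj' : j' = ⟨2 * l.val + 1, by have := l.isLt; omega⟩) :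
    |tailKernel ν S p q j j'| ≤ gTail j j' * (Real.sqrt (PpSq j p) * Real.sqrt (PpSq j' q)) := by
  subst hj hj'
  exact tail_bound_caseE_inner hν hS p q l

/-- Case D with the slot indices as variables. [cite: ArmstrongVicol2025, §3] -/
theorem tail_bound_caseD' {ν : ℝ} (hν : ν ∈ Ioc (0:ℝ) (1 / 40)) {S : T4} (hS : Torus.NearIso S (10 / 11) (11 / 10)) (p q : Fin 3 → ℝ)
    (l : Fin 13) {j j' : Fin 26} (hj : j = sndSlot l) (hj' : j' = fstSlot l) :
    |tailKernel ν S p q j j'| ≤ gTail j j' * (Real.sqrt (PpSq j p) * Real.sqrt (PpSq j' q)) := by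
  subst hj hj'
  exact tail_bound_caseD hν hS p q l

/-- **`hbound`**: `|tailKernel ν S p q j j'| ≤ gTail j j'·(√PpSq_j(p)·√PpSq_{j'}(q))` for every ordered slot pair (cases A–E). [cite: ArmstrongVicol2025, §3] -/
theorem tail_bound_all {ν : ℝ} (hν : ν ∈ Ioc (0:ℝ) (1 / 40)) {S : T4} (hS : Torus.NearIso S (10 / 11) (11 / 10)) (p q : Fin 3 → ℝ) (j j' : Fin 26) :
    |tailKernel ν S p q j j'| ≤ gTail j j' * (Real.sqrt (PpSq j p) * Real.sqrt (PpSq j' q)) := by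
  by_cases hC : j = j'
  · subst hC; exact tail_bound_caseC hν hS p q j
  by_cases hA : j'.val + 2 ≤ j.val
  · exact tail_bound_caseA hν hS p q hA
  by_cases hB : j.val < j'.val
  · by_cases hw : j.val = 0 ∧ j'.val = 25
    · obtain ⟨h0, h25⟩ := hw
      have hj : j = 0 := Fin.ext h0
      have hj' : j' = 25 := Fin.ext h25
      subst hj hj'
      exact tail_bound_caseE_wrap hν hS p q
    · exact tail_bound_caseB hν hS p q hB hw
  -- remaining: `j = j' + 1`
  have hjne : j.val ≠ j'.val := fun h => hC (Fin.ext h)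
  have hval : j.val = j'.val + 1 := by omega
  rcases Nat.even_or_odd j'.val with ⟨k, hk⟩ | ⟨k, hk⟩
  · -- forward colinear pair `(2k+1, 2k)`
    have hk13 : k < 13 := by have := j'.isLt; omega
    exact tail_bound_caseD' hν hS p q ⟨k, hk13⟩ (Fin.ext (by simp only [sndSlot]; omega)) (Fin.ext (by simp only [fstSlot]; omega))
  · -- adjacent non-colinear pair `(2k+2, 2k+1)`
    have hk12 : k < 12 := by have := j.isLt; omega
    exact tail_bound_caseE_inner' hν hS p q ⟨k, hk12⟩ (Fin.ext (by simp only; omega)) (Fin.ext (by simp only; omega))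

/-! ## §3 The registered stub and the v17 text -/

/-- **REGISTERED STUB `stub_D1_slotPairData` (K1L_D registry v18/v19, lane A, BY NAME).**  On the viscosity window `ν ∈ (0, νB₁]` and the block window
`NearIso S (10/11) (11/10)` (the sectorial hypotheses are carried for the interface only): there are a table `g` of Frobenius weight `≤ (1/23)²` and a
slot-pair presentation `F` of the bilinear symbol of the tail `psiStar − excQS − pairQS` with `|F p q j j'| ≤ g j j'·√PpSq_j(p)·√PpSq_{j'}(q)` —
namely `g = gTail`, `F = tailKernel ν S`. [cite: ArmstrongVicol2025, §3 (renormalised diffusivity of one level)] [cite: MajdaKramer1999, §2.2.1.3 (55)] -/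
theorem stub_D1_slotPairData : ∀ ν ∈ Set.Ioc 0 WCrossing.νB₁, ∀ S : Torus.Visc4 (Fin 3), Torus.NearIso S (10 / 11) (11 / 10) →
    ∀ τ ∈ Set.Icc (0:ℝ) (1 / 20), OddSectorial S τ →
      ∃ g : Fin 26 → Fin 26 → ℝ, (∑ j, ∑ j', g j j' ^ 2 / (D1TailCert.wN j * D1TailCert.wN j') ≤ (1 / 23) ^ 2) ∧
      ∃ F : (Fin 3 → ℝ) → (Fin 3 → ℝ) → Fin 26 → Fin 26 → ℝ,
        (∀ k p q : Fin 3 → ℝ, ∑ i, p i * k i = 0 → ∑ i, q i * k i = 0 →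
          Torus.bsymb
            (Sideband.psiStar Summit.AnomalousDissipation.AnomalousDissipation.Theorems.cubatureWord WCrossing.MB WCrossing.MB_pos ν S
              - excQS Summit.AnomalousDissipation.AnomalousDissipation.Theorems.cubatureWord WCrossing.MB S - D1ResidueCert.pairQS S) k p q
            = ∑ j, ∑ j', D1ResidueCert.ek j k * D1ResidueCert.ek j' k * F p q j j') ∧
        (∀ p q : Fin 3 → ℝ, ∀ j j', |F p q j j'| ≤ g j j' * (Real.sqrt (D1ResidueCert.PpSq j p) * Real.sqrt (D1ResidueCert.PpSq j' q))) := by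
  intro ν hν S hS τ _ _
  have hν' : ν ∈ Ioc (0:ℝ) (1 / 40) := hν
  exact ⟨gTail, frob_gTail_le, tailKernel ν S, fun k p q _ _ => bsymb_tail_eq_slotPair hν'.1 S k p q, fun p q j j' => tail_bound_all hν' hS p q j j'⟩

/-- **The v17 text `stub_D1_residueTail`** (a theorem in-skeleton since v18): the tail is `RelSmall` of size `1/200000` relative to `excQS`, uniformly in
`ν ∈ (0, νB₁]` on the block window. [cite: ArmstrongVicol2025, §3 (renormalised diffusivity of one level)] -/
theorem stub_D1_residueTail : ∀ ν ∈ Set.Ioc 0 WCrossing.νB₁, ∀ S : Torus.Visc4 (Fin 3), Torus.NearIso S (10 / 11) (11 / 10) →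
    ∀ τ ∈ Set.Icc (0:ℝ) (1 / 20), OddSectorial S τ →
      WCrossing.RelSmall
        (Sideband.psiStar Summit.AnomalousDissipation.AnomalousDissipation.Theorems.cubatureWord WCrossing.MB WCrossing.MB_pos ν S
          - excQS Summit.AnomalousDissipation.AnomalousDissipation.Theorems.cubatureWord WCrossing.MB S - D1ResidueCert.pairQS S)
        (excQS Summit.AnomalousDissipation.AnomalousDissipation.Theorems.cubatureWord WCrossing.MB S) (1 / 200000) := by
  intro ν hν S hS τ hτ hodd
  obtain ⟨g, hg, F, hs, hb⟩ := stub_D1_slotPairData ν hν S hS τ hτ hodd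
  exact relSmall_tail_of_table hg hS hτ hodd F hs hb

end Summit.AnomalousDissipation.AnomalousDissipation.Theorems.SolenoidalFractalHomogenisation.LagrangianStep.D1Tail

end
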